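import Summits.ResolutionOfSingularities.ResolutionOfSingularities.Theses.Valuative
import Literature.AlgebraicGeometry.Resolution.ResolutionLU

/-!
# `Theses.Valuative.ValuativeThesis` is the summit (item `stmt-ResolutionOfSingularities-0558`)

The absolute valuative thesis of route `Valuative`,
`ValuativeThesis = ∀ p prime, LU_p ∧ (LU_p → ResolutionInChar p)`
(`LU_p` = Zariski local uniformization in characteristic `p`: every valuation ring `O ⊇ k` of a
finitely generated `K/k`, `char k = p`, contains a finitely generated `k`-subalgebra `A` with
`Frac A = K` regular at the centre `𝔪_O ∩ A`), is **equivalent** to the summit statement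
`ResolutionOfSingularities = ∀ p prime, ResolutionInChar p`:

* `→`: modus ponens prime by prime (this is the proved assembly `Assembly_holds`);
* `←`: resolution in characteristic `p` implies local uniformization in characteristic `p`
  (Zariski 1940 read backwards, by the valuative criterion of properness; in tree as
  `Literature.AlgebraicGeometry.Resolution.ResolutionInChar.localUniformizationInChar`,
  `Literature/AlgebraicGeometry/Resolution/ResolutionLU.lean`), and the patching conjunct is then
  trivially true.

Hence the item has no failure mode and no proof independent of the summit: it is a *problem
decider*. We also record that it is equivalent to the route's live target `ValuativeThesisRel`
(relative form, item `stmt-0639`) — `←` by specialising the relative statement to `R = ⊥`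
(`Literature.AlgGeom.localUniformization_of_rel`), `→` through the summit and
`Literature.AlgebraicGeometry.Resolution.lurel_of_resolutionInChar` — and that it follows from the
hypotheses of the route's deciding theorem `closes`.

All statements here are pure logic over the cited in-tree theorems; nothing is vendored.
-/

set_option linter.dupNamespace false  -- Summit.<S>.<S>.Theorems is the D-0017 layout (single-conjunct summit)

namespace Summit.ResolutionOfSingularities.ResolutionOfSingularities.Theorems

open Summit.ResolutionOfSingularities.ResolutionOfSingularities.Theses.Valuative
open Literature.AlgebraicGeometry.Resolution

/-- The local-uniformization conjunct of `ValuativeThesis` at a prime `p` is, verbatim, the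
Literature predicate `LocalUniformizationInChar.{0} p` (`IsLocallyUniformizable` unfolded).
[folklore] -/
theorem localUniformizationInChar_iff (p : ℕ) :
    LocalUniformizationInChar.{0} p ↔
      ∀ (k K : Type) [Field k] [CharP k p] [Field K] [Algebra k K],
        (⊤ : IntermediateField k K).FG → ∀ O : ValuationSubring K,
          (∀ c : k, algebraMap k K c ∈ O) →
            ∃ (A : Subalgebra k K) (h : A.toSubring ≤ O.toSubring), A.FG ∧ IsFractionRing A K ∧
              IsRegularLocalRing (Localization.AtPrime
                (Ideal.comap (Subring.inclusion h) (IsLocalRing.maximalIdeal O))) :=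
  Iff.rfl

/-- **Resolution in characteristic `p` gives both conjuncts of the absolute valuative thesis at
`p`**: `LU_p` by `ResolutionInChar.localUniformizationInChar` (Zariski 1940 read backwards, via the
valuative criterion of properness), and `LU_p → ResolutionInChar p` trivially. [folklore] -/
theorem valuativeThesis_conjuncts_of_resolutionInChar {p : ℕ} (h : ResolutionInChar.{0} p) :
    (∀ (k K : Type) [Field k] [CharP k p] [Field K] [Algebra k K],
        (⊤ : IntermediateField k K).FG → ∀ O : ValuationSubring K,
          (∀ c : k, algebraMap k K c ∈ O) →
            ∃ (A : Subalgebra k K) (h : A.toSubring ≤ O.toSubring), A.FG ∧ IsFractionRing A K ∧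
              IsRegularLocalRing (Localization.AtPrime
                (Ideal.comap (Subring.inclusion h) (IsLocalRing.maximalIdeal O)))) ∧
    ((∀ (k K : Type) [Field k] [CharP k p] [Field K] [Algebra k K],
        (⊤ : IntermediateField k K).FG → ∀ O : ValuationSubring K,
          (∀ c : k, algebraMap k K c ∈ O) →
            ∃ (A : Subalgebra k K) (h : A.toSubring ≤ O.toSubring), A.FG ∧ IsFractionRing A K ∧
              IsRegularLocalRing (Localization.AtPrime
                (Ideal.comap (Subring.inclusion h) (IsLocalRing.maximalIdeal O)))) →
      ResolutionInChar.{0} p) :=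
  ⟨(localUniformizationInChar_iff p).mp h.localUniformizationInChar, fun _ => h⟩

/-- **The absolute valuative thesis is equivalent to the summit.** `ValuativeThesis`
(`∀ p prime, LU_p ∧ (LU_p → ResolutionInChar p)`) holds iff `ResolutionOfSingularities`
(`∀ p prime, ResolutionInChar p`): `→` is modus ponens (the route's proved `Assembly`), `←` is
`valuativeThesis_conjuncts_of_resolutionInChar`. In particular item `stmt-0558` has no failure
mode and no proof independent of the summit. [folklore] -/
theorem valuativeThesis_iff_resolutionOfSingularities :
    ValuativeThesis ↔ _root_.ResolutionOfSingularities :=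
  ⟨fun h p hp => (h p hp).2 (h p hp).1,
    fun h p hp => valuativeThesis_conjuncts_of_resolutionInChar (h p hp)⟩

/-- `ValuativeThesis` at a single prime: the thesis holds iff resolution holds in every prime
characteristic, prime by prime. [folklore] -/
theorem valuativeThesis_iff_forall_resolutionInChar :
    ValuativeThesis ↔ ∀ p : ℕ, p.Prime → ResolutionInChar.{0} p :=
  valuativeThesis_iff_resolutionOfSingularities.trans _root_.ResolutionOfSingularities_iff

/-- **Relative ⇒ absolute.** The route's live target `ValuativeThesisRel` (item `stmt-0639`:
relative local uniformization `LUrel_p` and `LUrel_p → ResolutionInChar p` for every prime `p`)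
implies the absolute thesis: `LUrel_p` gives `ResolutionInChar p` by its own patching conjunct,
and then both absolute conjuncts by `valuativeThesis_conjuncts_of_resolutionInChar` (equivalently:
specialise `LUrel_p` to `R = ⊥`, `Literature.AlgGeom.localUniformization_of_rel`). [folklore] -/
theorem valuativeThesis_of_valuativeThesisRel (h : ValuativeThesisRel) : ValuativeThesis :=
  fun p hp => valuativeThesis_conjuncts_of_resolutionInChar ((h p hp).2 (h p hp).1)

/-- **Absolute ⇒ relative.** Conversely the absolute thesis implies the relative target: it gives
`ResolutionInChar p` (`valuativeThesis_iff_forall_resolutionInChar`), whence `LUrel_p` by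
`Literature.AlgebraicGeometry.Resolution.lurel_of_resolutionInChar` (resolve `Spec` of an affine
model containing `R`, take the chart at the centre) and the patching conjunct trivially.
[folklore] -/
theorem valuativeThesisRel_of_valuativeThesis (h : ValuativeThesis) : ValuativeThesisRel := by
  intro p hp
  have hres : ResolutionInChar.{0} p := valuativeThesis_iff_forall_resolutionInChar.mp h p hp
  exact ⟨lurel_of_resolutionInChar p hp hres, fun _ => hres⟩

/-- The absolute thesis (item `stmt-0558`) and the relative target (item `stmt-0639`) of route
`Valuative` are equivalent — both are equivalent to the summit. [folklore] -/
theorem valuativeThesis_iff_valuativeThesisRel : ValuativeThesis ↔ ValuativeThesisRel :=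
  ⟨valuativeThesisRel_of_valuativeThesis, valuativeThesis_of_valuativeThesisRel⟩

/-- The relative target is likewise equivalent to the summit. [folklore] -/
theorem valuativeThesisRel_iff_resolutionOfSingularities :
    ValuativeThesisRel ↔ _root_.ResolutionOfSingularities :=
  valuativeThesis_iff_valuativeThesisRel.symm.trans valuativeThesis_iff_resolutionOfSingularities

/-- **Conditional closure from the route's cruxes.** Under the hypotheses of the deciding theorem
`closes` — local uniformization of `α_p`-torsors over bases regular at the centre
(`LuAlphaPTorsor`), Temkin's inseparable reduction (`TorsorToLurel`) and Zariski patching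
(`PatchingRel`) — the absolute valuative thesis holds. [folklore] -/
theorem valuativeThesis_of_cruxes (h₂ : LuAlphaPTorsor) (h₄ : TorsorToLurel) (h₃ : PatchingRel) :
    ValuativeThesis :=
  valuativeThesis_iff_resolutionOfSingularities.mpr (closes h₂ h₄ h₃)

/-! ## Prime by prime; the kill criterion; the absolute frame (appended 2026-08-16) -/

/-- **Prime by prime, the thesis is resolution in characteristic `p`.** For every `p` the
`p`-component `LU_p ∧ (LU_p → ResolutionInChar p)` of `ValuativeThesis` holds iff
`ResolutionInChar p` (`→` modus ponens, `←` by `ResolutionInChar.localUniformizationInChar`):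
the item has no failure mode independent of the summit in that characteristic. [folklore] -/
theorem valuativeThesisAt_iff_resolutionInChar (p : ℕ) :
    (LocalUniformizationInChar.{0} p ∧ (LocalUniformizationInChar.{0} p → ResolutionInChar.{0} p)) ↔
      ResolutionInChar.{0} p :=
  ⟨fun h => h.2 h.1, fun h => ⟨h.localUniformizationInChar, fun _ => h⟩⟩

/-- **Kill criterion.** `ValuativeThesis` fails iff resolution of singularities fails in SOME
prime characteristic `p` — a refutation of the item is a counterexample to the summit, nothing
weaker. [folklore] -/
theorem not_valuativeThesis_iff :
    ¬ ValuativeThesis ↔ ∃ p : ℕ, p.Prime ∧ ¬ ResolutionInChar.{0} p := by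
  rw [valuativeThesis_iff_forall_resolutionInChar]
  push Not
  rfl

/-- `ValuativeThesis` splits as "local uniformization in every prime characteristic" AND the
route's absolute patching item `Patching` (stmt-0561, `∀ p prime, LU_p → ResolutionInChar p`).
[folklore] -/
theorem valuativeThesis_iff_forall_lu_and_patching :
    ValuativeThesis ↔ (∀ p : ℕ, p.Prime → LocalUniformizationInChar.{0} p) ∧ Patching :=
  ⟨fun h => ⟨fun p hp => (h p hp).1, fun p hp => (h p hp).2⟩, fun h p hp => ⟨h.1 p hp, h.2 p hp⟩⟩

/-- **The absolute frame composes.** The route's superseded absolute items assemble to the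
absolute thesis by pure logic: `Lupi` (stmt-0560, LU for purely inseparable hypersurface function
fields), `LupiToLu` (stmt-0562, Temkin's reduction `LUPI_p → LU_p`) and `Patching` (stmt-0561,
`LU_p → ResolutionInChar p`) give `ValuativeThesis` (stmt-0558) — hence, with `Assembly_holds`,
the summit. [folklore] -/
theorem valuativeThesis_of_lupi_lupiToLu_patching (h₁ : Lupi) (h₂ : LupiToLu) (h₃ : Patching) :
    ValuativeThesis :=
  fun p hp => ⟨h₂ p hp (h₁ p hp), h₃ p hp⟩

/-- Conversely the absolute thesis returns each absolute item: `Lupi`, `LupiToLu` and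
`Patching` all follow from `ValuativeThesis` (the first two because their consequent `LU_p`
holds outright). [folklore] -/
theorem lupi_lupiToLu_patching_of_valuativeThesis (h : ValuativeThesis) :
    Lupi ∧ LupiToLu ∧ Patching := by
  have hLU : ∀ p : ℕ, p.Prime → LocalUniformizationInChar.{0} p := fun p hp => (h p hp).1
  refine ⟨?_, fun p hp _ => hLU p hp, fun p hp => (h p hp).2⟩
  intro p hp k K _ _ _ _ n x t _ _ htop O hO
  classical
  refine hLU p hp k K ⟨insert t (Finset.univ.image x), ?_⟩ O hO
  simpa [Finset.coe_insert, Finset.coe_image, Set.image_univ] using htop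

end Summit.ResolutionOfSingularities.ResolutionOfSingularities.Theorems
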